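import Summits.BirchSwinnertonDyer.BirchSwinnertonDyer.Theorems.KolyvaginDepthDoorKolyvaginDepthSupplyMinimalDepth
import Summits.BirchSwinnertonDyer.BirchSwinnertonDyer.Theorems.KolyvaginDepthDoorDepthTableRowKitPrint
import Summits.BirchSwinnertonDyer.BirchSwinnertonDyer.Theorems.Rank2ObservatoryReductionWitness3
import HarnessLib

/-!
# Route `KolyvaginDepthDoor` — the DEPTH-TABLE ROW KIT ON THE SECOND SIGN (crux `KolyvaginDepthSupply`,
# stmt-BirchSwinnertonDyer-21765): rank-ONE curves whose Heegner twist has rank TWO, through the door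
# `…DoorSecondSign`, with a kernel-checkable bridge to the rank certificates of the twist

Helper file (`--supports stmt-BirchSwinnertonDyer-21765 --as helper`); it closes nothing and BSD is
not proved by it.

WHY. Every filled row of the route's depth table so far (g2–g9: the 18 Cremona rank-2 curves
`N ≤ 1000`, the 9 rank-3 curves) sits on the crux's FIRST rank clause
`ν + 1 = rank E(ℚ) > rank E^{(d_K)}(ℚ)`. g9 typed the door on the SECOND clause
`ν = rank E(ℚ) = rank E^{(d_K)}(ℚ) − 1` (`door_of_hypothesesDepth_of_twist_rank`,
`shaCorank_eq_zero_of_kolyvaginClass_ne_zero_of_twist_rank_of_datum_kodairaNeron`) but no ROW could be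
written on it: its points-first input is `ν + 1 ≤ rank_ℤ E^{(d_K)}(ℚ)`, a rank certificate FOR A
QUADRATIC TWIST, and the tree's kernel rank certificates (`Rank2Observatory…`) are stated for integer
models `V ⊗ ℚ`, not for the (non-integral) equation `W.quadraticTwist d` of
`Literature…QuadraticTwist`. This file supplies the bridge and the assembled kit:

* `variableChange_quadraticTwist_eq_map_twistModel` — for a globally minimal `W/ℚ` with integer
  model `E₀` and any `D : ℤ`, the admissible change of variables `u = 1/2` carries
  `W.quadraticTwist D = [0, D b₂/4, 0, D² b₄/2, D³ b₆/4]` to the INTEGER equation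
  `[0, D b₂, 0, 8 D² b₄, 16 D³ b₆] ⊗ ℚ` (`bᵢ = bᵢ(E₀)`), the "twist model" on which
  `Rank2Observatory.two_le_mordellWeilRank_of_ratCert` runs;
* `mordellWeilRank_quadraticTwist_eq_twistModel` — hence `rank_ℤ E^{(D)}(ℚ) = rank_ℤ` of that integer
  equation (`VariableChange.finrank_point_variableChange`, AEC III.3.1 (b));
* `depthRowSecondSign_print_of_datum_of_intModel_certificate` — **THE ROW KIT ON THE SECOND SIGN**:
  inputs = an integer-model certificate of the side conditions exactly as in g8's first-sign kit
  `depthRow_print_of_datum_of_intModel_certificate` (non-CM, `ρ̄_{E,p^n}` onto for all `n`, Heegner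
  discriminant `D ∉ {−3, −4}` read off `Δ(E₀)`, a Kolyvagin prime `ℓ` with `M(ℓ) ≥ 1` read off
  `#(E₀ mod ℓ)(𝔽_ℓ)`, the `decide`-able Kodaira–Néron table (KN_p) of `Δ(E₀)`), the ONE named input
  (γ) = `GrossLMS1991.prop37_2_frobeniusCongruence`, and — points first — `1 ≤ rank_ℤ E(ℚ)` and
  `2 ≤ rank_ℤ` OF THE TWIST MODEL; OUTPUT from the bit `d.kolyvaginClass _ 1 ≠ 0` at ANY datum `d` of
  conductor `ℓ`: `corank_{ℤ_p} Ш(E)[p^∞] = 0`, `rank_ℤ E(ℚ) = 1`, `corank_{ℤ_p} Ш(E^{(D)})[p^∞] = 0`,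
  `rank_ℤ E^{(D)}(ℚ) = 2`, `E(ℚ)[p] = 0`, `Ш(E/ℚ)[p] = 0`, `#Sel^(p)(E/ℚ) = p`, `Ш(E^{(D)}/ℚ)[p] = 0`,
  `#Sel^(p)(E^{(D)}/ℚ) = p²`;
* `kolyvaginDepthSupply_rankClause_two_of_intModel_certificate` — the crux's second rank clause
  VERBATIM at the row: `ν(ℓ) = rank_ℤ E(ℚ) ∧ rank_ℤ E^{(d_K)}(ℚ) = rank_ℤ E(ℚ) + 1`.
* (appended) `depthRowZeroTwist_vanishes_printKN_of_intModel_certificate` — the BIT-FREE companion: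
  `2 ≤ rank_ℤ` of the twist model alone forces every depth-ZERO class to vanish, `c_1(1) = 0` in
  `H¹(K, E[p])` (g9's `kolyvaginClass_eq_zero_of_rank_of_datum_kodairaNeron`, twist disjunct), on (γ)
  only — the mod-`p` shadow, read off two rational points of `E^{(D)}`, of the torsion Heegner point
  `y_K` that Gross–Zagier attaches to `L'(E/K, 1) = 0`.

What such a row says about RANK TWO: the twist `E^{(D)}` is a rank-2 elliptic curve over `ℚ` (of
conductor `N D²`, additive at the primes of `D`) which NO first-sign row can reach through the same
field `K = ℚ(√D)` (the Heegner hypothesis fails for `N D²`); the second-sign row certifies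
`Ш(E^{(D)}/ℚ)[p] = 0` and `rank_ℤ E^{(D)}(ℚ) = 2` exactly, from one non-zero depth-1 class of the
rank-ONE curve `E` over `K`. CONDITIONAL on (γ) and the bit; per-curve; nothing class-wide is
asserted; BSD is not proved by it.

References: [Kolyvagin1991MathAnn] V. A. Kolyvagin, Math. Ann. 291 (1991), Thm. 2.3;
[GrossLMS1991] Prop. 3.7 (2), §5 (5.1), Prop. 6.2 (1); [McCallumLMS1991] §§2–5;
[SilvermanAEC2009] III.1 Table 3.1, III.3.1 (b), VII.6.1, Thm. VIII.6.7, X.2 Prop. 2.4, X.5 Cor. 5.4;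
[WZhang2014] Notations (xii); [JetchevLauterStein2009] §3.6 (arXiv:0707.0032).
-/

set_option linter.dupNamespace false

noncomputable section

open scoped Classical NumberField

namespace Summit.BirchSwinnertonDyer.BirchSwinnertonDyer.Theorems.KolyvaginDepthDoor

open Literature.NumberTheory.EllipticCurves Literature.NumberTheory.EllipticCurves.ModularForms
  Literature.NumberTheory.EllipticCurves.McCallum1991 WeierstrassCurve NumberField IsDedekindDomain
open Literature.NumberTheory.DiophantineGeometry (KodairaSymbol)
open Summit.BirchSwinnertonDyer.BirchSwinnertonDyer.Rank1Residual

/-! ## §1 The twist model: `W.quadraticTwist D` is `[0, D b₂, 0, 8 D² b₄, 16 D³ b₆] ⊗ ℚ` up to `u = 1/2` -/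

section TwistModel

variable {W : WeierstrassCurve ℚ} [W.IsGloballyMinimal] {E₀ : WeierstrassCurve ℤ}
  (hI : integralModelInt W = E₀)
include hI

/-- **The twist model.** For a globally minimal `W/ℚ` with integer model `E₀` and `D : ℤ`, the
admissible change of variables `(u, r, s, t) = (1/2, 0, 0, 0)` (`aᵢ ↦ 2ⁱ aᵢ`) carries the equation
`W.quadraticTwist D = [0, D b₂/4, 0, D² b₄/2, D³ b₆/4]` (`Literature…QuadraticTwist`, Silverman X.2
after Prop. 2.4) to the INTEGER equation `[0, D b₂, 0, 8 D² b₄, 16 D³ b₆]` read over `ℚ`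
(`bᵢ = bᵢ(E₀)`). [cite: SilvermanAEC2009, III.1 Table 3.1 and X.5 Cor. 5.4] -/
theorem variableChange_quadraticTwist_eq_map_twistModel (D : ℤ) :
    (⟨⟨(2 : ℚ)⁻¹, 2, by norm_num, by norm_num⟩, 0, 0, 0⟩ : VariableChange ℚ) •
        W.quadraticTwist (D : ℚ) =
      (⟨0, D * E₀.b₂, 0, 8 * D ^ 2 * E₀.b₄, 16 * D ^ 3 * E₀.b₆⟩ : WeierstrassCurve ℤ).map
        (Int.castRingHom ℚ) := by
  have hW : W = E₀.baseChange ℚ := eq_baseChange_of_intModel hI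
  have hb₂ : W.b₂ = (E₀.b₂ : ℚ) := by rw [hW]; simp [WeierstrassCurve.baseChange]
  have hb₄ : W.b₄ = (E₀.b₄ : ℚ) := by rw [hW]; simp [WeierstrassCurve.baseChange]
  have hb₆ : W.b₆ = (E₀.b₆ : ℚ) := by rw [hW]; simp [WeierstrassCurve.baseChange]
  ext
  · simp [variableChange_a₁, WeierstrassCurve.map]
  · simp only [variableChange_a₂, quadraticTwist_a₁, quadraticTwist_a₂, hb₂, WeierstrassCurve.map]
    push_cast
    simp [inv_inv]
    ring
  · simp [variableChange_a₃, WeierstrassCurve.map]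
  · simp only [variableChange_a₄, quadraticTwist_a₁, quadraticTwist_a₂, quadraticTwist_a₃,
      quadraticTwist_a₄, hb₄, WeierstrassCurve.map]
    push_cast
    simp [inv_inv]
    ring
  · simp only [variableChange_a₆, quadraticTwist_a₁, quadraticTwist_a₂, quadraticTwist_a₃,
      quadraticTwist_a₄, quadraticTwist_a₆, hb₆, WeierstrassCurve.map]
    push_cast
    simp [inv_inv]
    ring

/-- **`rank_ℤ E^{(D)}(ℚ)` IS the rank of the twist model** `[0, D b₂, 0, 8 D² b₄, 16 D³ b₆] ⊗ ℚ`
(the Mordell–Weil rank is invariant under admissible changes of variables,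
`VariableChange.finrank_point_variableChange`; Silverman AEC III.3.1 (b)). This is the bridge from the
route's binder `(W.quadraticTwist d_K).mordellWeilRank` to the kernel rank certificates
`Rank2Observatory.two_le_mordellWeilRank_of_ratCert` / `…_of_kernelCert`, which are stated for
integer equations. [cite: SilvermanAEC2009, III.3.1 (b) and Thm. VIII.6.7] -/
theorem mordellWeilRank_quadraticTwist_eq_twistModel (D : ℤ) :
    (W.quadraticTwist (D : ℚ)).mordellWeilRank =
      ((⟨0, D * E₀.b₂, 0, 8 * D ^ 2 * E₀.b₄, 16 * D ^ 3 * E₀.b₆⟩ : WeierstrassCurve ℤ).map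
        (Int.castRingHom ℚ)).mordellWeilRank := by
  rw [← variableChange_quadraticTwist_eq_map_twistModel hI D]
  exact (@WeierstrassCurve.VariableChange.finrank_point_variableChange ℚ _
    (W.quadraticTwist (D : ℚ)) _ (Classical.decEq ℚ)).symm

end TwistModel

/-! ## §2 The row kit on the second sign -/

section Generic

variable {W : WeierstrassCurve ℚ} [W.IsElliptic] [W.IsGloballyMinimal] {E₀ : WeierstrassCurve ℤ}
  (hI : integralModelInt W = E₀)
include hI

/-- **The depth-table row ON THE SECOND SIGN off an integer model, print-standard inputs (no McCallum
leaf, no `hF`, no system).** Inputs: globally minimal non-CM `W/ℚ` with integer model `E₀`;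
`p` odd with `ρ̄_{E,p^n}` onto for all `n`; an imaginary quadratic `K` with `d_K = D ∉ {−3, −4}` in
which every prime of `Δ(E₀)` splits; an odd prime `ℓ ∤ Δ(E₀) D`, `ℓ ≠ p`, `(D/ℓ) = −1`, `p ∣ ℓ + 1`,
`p ∣ ℓ + 1 − #(E₀ mod ℓ)(𝔽_ℓ)`; (γ) = `GrossLMS1991.prop37_2_frobeniusCongruence`; the Kodaira–Néron
table of `Δ(E₀) = Δ₀` at `p` and — void for `p ≠ 3` — no additive place of type IV / IV*; and, POINTS
FIRST on the second sign, `1 ≤ rank_ℤ E(ℚ)` and `2 ≤ rank_ℤ` of the TWIST MODEL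
`V = [0, D b₂, 0, 8 D² b₄, 16 D³ b₆] ⊗ ℚ` (displayed as a literal through `hV`, so that the kernel
certificates of the tree apply to it verbatim); a frame
`(Dt, β, ι)` and ONE datum `d : KolyvaginHeegnerData Dt β ι ℓ`. OUTPUT from the bit
`d.kolyvaginClass hp 1 ≠ 0`: `corank_{ℤ_p} Ш(E/ℚ)[p^∞] = 0`, `rank_ℤ E(ℚ) = 1`,
`corank_{ℤ_p} Ш(E^{(D)}/ℚ)[p^∞] = 0`, `rank_ℤ E^{(D)}(ℚ) = 2`, `E(ℚ)[p] = 0`, `Ш(E/ℚ)[p] = 0`,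
`#Sel^(p)(E/ℚ) = p`, `Ш(E^{(D)}/ℚ)[p] = 0`, `#Sel^(p)(E^{(D)}/ℚ) = p²` (g9's
`shaCorank_eq_zero_of_kolyvaginClass_ne_zero_of_twist_rank_of_datum_kodairaNeron` fed with the
certified side conditions of `…DepthTableRowKit` / `…RowKitPrint` and the bridge
`mordellWeilRank_quadraticTwist_eq_twistModel`). CONDITIONAL on (γ) and the bit; per-curve; BSD is
not proved by it. [cite: Kolyvagin1991MathAnn, Thm. 2.3] [cite: GrossLMS1991, Prop. 3.7 (2), §5 (5.1), Prop. 6.2 (1)]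
[cite: McCallumLMS1991, §§2–5] [cite: SilvermanAEC2009, VII.6.1 and Thm. X.4.2] [cite: WZhang2014, Notations (xii)]
[cite: JetchevLauterStein2009, §3.6 (arXiv:0707.0032)] -/
theorem depthRowSecondSign_print_of_datum_of_intModel_certificate
    (h372 : GrossLMS1991.prop37_2_frobeniusCongruence)
    (hcm : ¬ W.HasCM) (hr : 1 ≤ W.mordellWeilRank)
    (p : ℕ) [hp : Fact p.Prime] (hp2 : p ≠ 2)
    (htower : ∀ n : ℕ, W.HasSurjectiveModNGaloisRep (p ^ n : ℕ))
    (K : Type) [Field K] [NumberField K] (hK : IsImaginaryQuadratic K) {D : ℤ}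
    (hD : NumberField.discr K = D) (h3 : D ≠ -3) (h4 : D ≠ -4)
    {V : WeierstrassCurve ℤ}
    (hV : (⟨0, D * E₀.b₂, 0, 8 * D ^ 2 * E₀.b₄, 16 * D ^ 3 * E₀.b₆⟩ : WeierstrassCurve ℤ) = V)
    (hr' : 2 ≤ (V.map (Int.castRingHom ℚ)).mordellWeilRank)
    (hH : ∀ q : ℕ, q.Prime → (q : ℤ) ∣ E₀.Δ → (q = 2 → D % 8 = 1) ∧ (q ≠ 2 → jacobiSym D q = 1))
    (ℓ : ℕ) (hℓ : ℓ.Prime) (hℓ2 : ℓ ≠ 2) (hℓΔ : ¬ (ℓ : ℤ) ∣ E₀.Δ) (hℓD : ¬ (ℓ : ℤ) ∣ D)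
    (hℓp : ℓ ≠ p) (hjac : jacobiSym D ℓ = -1) (hℓ1 : p ∣ ℓ + 1) {n : ℕ}
    (hcard : Nat.card ((E₀.map (Int.castRingHom (ZMod ℓ))).toAffine.Point) = n)
    (haℓ : (p : ℤ) ∣ (ℓ : ℤ) + 1 - n)
    {Δ₀ : ℤ} (hΔ : E₀.Δ = Δ₀) {B : ℕ} (hB : Δ₀.natAbs < B ^ p)
    (htab : ∀ q ∈ Finset.range B, q.Prime → q ∣ Δ₀.natAbs →
      ∃ e ∈ Finset.range 64, q ^ e ∣ Δ₀.natAbs ∧ ¬ q ^ (e + 1) ∣ Δ₀.natAbs ∧ ¬ p ∣ e)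
    (hadd : ∀ v : HeightOneSpectrum (𝓞 ℚ), W.HasAdditiveReductionAt v → p ≠ 3 ∨
      (W.kodairaSymbolAt v ≠ KodairaSymbol.IV ∧ W.kodairaSymbolAt v ≠ KodairaSymbol.IVstar))
    [NeZero (W.conductorNorm ℤ)] (Dt : ModularParametrizationData W (W.conductorNorm ℤ)) (β : ℤ)
    (ι : K →+* ℂ) (d : KolyvaginHeegnerData Dt β ι ℓ) (hne : d.kolyvaginClass hp.out 1 ≠ 0) :
    W.shaCorank p = 0 ∧ W.mordellWeilRank = 1 ∧
      (W.quadraticTwist (D : ℚ)).shaCorank p = 0 ∧ (W.quadraticTwist (D : ℚ)).mordellWeilRank = 2 ∧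
      (∀ P : W.toAffine.Point, p • P = 0 → P = 0) ∧ (∀ c ∈ W.sha, p • c = 0 → c = 0) ∧
      Nat.card ↥(selmerGroup W (p : ℤ)) = p ∧
      (∀ c ∈ (W.quadraticTwist (D : ℚ)).sha, p • c = 0 → c = 0) ∧
      Nat.card ↥(selmerGroup (W.quadraticTwist (D : ℚ)) (p : ℤ)) = p ^ 2 := by
  obtain ⟨hkol, -⟩ := isKolyvaginPrime_of_intModel_certificate hI p K hK.1 hD ℓ hℓ hℓ2 hℓΔ hℓD
    hℓp hjac hℓ1 hcard haℓ
  obtain ⟨c, hc, hcc⟩ := exists_conj_of_isImaginaryQuadratic K hK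
  have hH' := satisfiesHeegnerHypothesis_conductorNorm_of_intModel hI K hK.1 hD hH
  have hmult : ∀ v : HeightOneSpectrum (𝓞 ℚ), W.HasMultiplicativeReductionAt v →
      ¬ p ∣ W.ordMinimalDiscriminant v :=
    not_dvd_ordMinimalDiscriminant_of_intModel_table hI hΔ hB htab
  have hcard1 : ℓ.primeFactors.card = 1 := by rw [hℓ.primeFactors, Finset.card_singleton]
  have hrank : ℓ.primeFactors.card ≤ W.mordellWeilRank := by rw [hcard1]; exact hr
  have hrank' : ℓ.primeFactors.card + 1 ≤
      (W.quadraticTwist (NumberField.discr K : ℚ)).mordellWeilRank := by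
    rw [hcard1, hD, mordellWeilRank_quadraticTwist_eq_twistModel hI D, hV]; exact hr'
  obtain ⟨hsha, hrk, hsha', hrk', ht, hbot, hSel, hbot', hSel'⟩ :=
    shaCorank_eq_zero_of_kolyvaginClass_ne_zero_of_twist_rank_of_datum_kodairaNeron h372 hcm hK
      (by rw [hD]; exact h3) (by rw [hD]; exact h4) hH' p hp2 htower c hc hcc hmult hadd
      hℓ.prime.squarefree
      (fun q hq ↦ by
        rw [hℓ.primeFactors, Finset.mem_singleton] at hq
        exact hq ▸ hkol) d hne hrank hrank'
  have hp1 : ((p ^ 1 : ℕ) : ℤ) = (p : ℤ) := by rw [pow_one]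
  rw [hp1] at ht hbot hSel hbot' hSel'
  rw [hcard1] at hrk hrk' hSel hSel'
  rw [hD] at hsha' hrk' hbot' hSel'
  rw [pow_one] at hSel
  refine ⟨hsha, hrk, hsha', hrk', fun P hP ↦ ?_, fun x hx hpx ↦ ?_, hSel, fun x hx hpx ↦ ?_, hSel'⟩
  · have hmem : P ∈ AddSubgroup.torsionBy W.toAffine.Point (p : ℤ) :=
      AddSubgroup.torsionBy.nsmul_iff.mpr hP
    rw [AddSubgroup.card_eq_one.mp ht] at hmem
    exact (AddSubgroup.mem_bot).mp hmem
  · have hmem : x ∈ W.sha ⊓ AddSubgroup.torsionBy W.galH1 (p : ℤ) :=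
      AddSubgroup.mem_inf.mpr ⟨hx, AddSubgroup.torsionBy.nsmul_iff.mpr hpx⟩
    rw [hbot] at hmem
    exact (AddSubgroup.mem_bot).mp hmem
  · have hmem : x ∈ (W.quadraticTwist (D : ℚ)).sha ⊓
        AddSubgroup.torsionBy (W.quadraticTwist (D : ℚ)).galH1 (p : ℤ) :=
      AddSubgroup.mem_inf.mpr ⟨hx, AddSubgroup.torsionBy.nsmul_iff.mpr hpx⟩
    rw [hbot'] at hmem
    exact (AddSubgroup.mem_bot).mp hmem

/-- **The crux's SECOND rank clause VERBATIM at a second-sign row**: in the setting of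
`depthRowSecondSign_print_of_datum_of_intModel_certificate`, the bit gives
`ν(ℓ) = rank_ℤ E(ℚ) ∧ rank_ℤ E^{(d_K)}(ℚ) = rank_ℤ E(ℚ) + 1` — the disjunct
`(n.primeFactors.card = W.mordellWeilRank ∧ (W.quadraticTwist d_K).mordellWeilRank =
W.mordellWeilRank + 1)` of `KolyvaginDepthSupply` with `n = ℓ`, read off the counted points.
CONDITIONAL on (γ) and the bit; per-curve; BSD is not proved by it.
[cite: Kolyvagin1991MathAnn, Thm. 2.3 and Thm. 4 (the two eigenspaces)] [cite: GrossLMS1991, §5 (5.1)] -/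
theorem kolyvaginDepthSupply_rankClause_two_of_intModel_certificate
    (h372 : GrossLMS1991.prop37_2_frobeniusCongruence)
    (hcm : ¬ W.HasCM) (hr : 1 ≤ W.mordellWeilRank)
    (p : ℕ) [hp : Fact p.Prime] (hp2 : p ≠ 2)
    (htower : ∀ n : ℕ, W.HasSurjectiveModNGaloisRep (p ^ n : ℕ))
    (K : Type) [Field K] [NumberField K] (hK : IsImaginaryQuadratic K) {D : ℤ}
    (hD : NumberField.discr K = D) (h3 : D ≠ -3) (h4 : D ≠ -4)
    {V : WeierstrassCurve ℤ}
    (hV : (⟨0, D * E₀.b₂, 0, 8 * D ^ 2 * E₀.b₄, 16 * D ^ 3 * E₀.b₆⟩ : WeierstrassCurve ℤ) = V)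
    (hr' : 2 ≤ (V.map (Int.castRingHom ℚ)).mordellWeilRank)
    (hH : ∀ q : ℕ, q.Prime → (q : ℤ) ∣ E₀.Δ → (q = 2 → D % 8 = 1) ∧ (q ≠ 2 → jacobiSym D q = 1))
    (ℓ : ℕ) (hℓ : ℓ.Prime) (hℓ2 : ℓ ≠ 2) (hℓΔ : ¬ (ℓ : ℤ) ∣ E₀.Δ) (hℓD : ¬ (ℓ : ℤ) ∣ D)
    (hℓp : ℓ ≠ p) (hjac : jacobiSym D ℓ = -1) (hℓ1 : p ∣ ℓ + 1) {n : ℕ}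
    (hcard : Nat.card ((E₀.map (Int.castRingHom (ZMod ℓ))).toAffine.Point) = n)
    (haℓ : (p : ℤ) ∣ (ℓ : ℤ) + 1 - n)
    {Δ₀ : ℤ} (hΔ : E₀.Δ = Δ₀) {B : ℕ} (hB : Δ₀.natAbs < B ^ p)
    (htab : ∀ q ∈ Finset.range B, q.Prime → q ∣ Δ₀.natAbs →
      ∃ e ∈ Finset.range 64, q ^ e ∣ Δ₀.natAbs ∧ ¬ q ^ (e + 1) ∣ Δ₀.natAbs ∧ ¬ p ∣ e)
    (hadd : ∀ v : HeightOneSpectrum (𝓞 ℚ), W.HasAdditiveReductionAt v → p ≠ 3 ∨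
      (W.kodairaSymbolAt v ≠ KodairaSymbol.IV ∧ W.kodairaSymbolAt v ≠ KodairaSymbol.IVstar))
    [NeZero (W.conductorNorm ℤ)] (Dt : ModularParametrizationData W (W.conductorNorm ℤ)) (β : ℤ)
    (ι : K →+* ℂ) (d : KolyvaginHeegnerData Dt β ι ℓ) (hne : d.kolyvaginClass hp.out 1 ≠ 0) :
    ℓ.primeFactors.card = W.mordellWeilRank ∧
      (W.quadraticTwist (NumberField.discr K : ℚ)).mordellWeilRank = W.mordellWeilRank + 1 := by
  obtain ⟨-, hrk, -, hrk', -⟩ := depthRowSecondSign_print_of_datum_of_intModel_certificate hI h372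
    hcm hr p hp2 htower K hK hD h3 h4 hV hr' hH ℓ hℓ hℓ2 hℓΔ hℓD hℓp hjac hℓ1 hcard haℓ hΔ hB htab hadd
    Dt β ι d hne
  rw [hℓ.primeFactors, Finset.card_singleton, hD, hrk, hrk']
  exact ⟨rfl, rfl⟩

end Generic

/-! ## §3 The bit-free companion: depth-ZERO classes vanish when the twist has two points -/

section Vanishing

variable {W : WeierstrassCurve ℚ} [W.IsElliptic] [W.IsGloballyMinimal] {E₀ : WeierstrassCurve ℤ}
  (hI : integralModelInt W = E₀)
include hI

/-- **Depth-ZERO vanishing row on the twist side, (γ) + a Kodaira–Néron certificate — NO bit, NO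
class computed.** Inputs as in `depthRowSecondSign_print_of_datum_of_intModel_certificate` minus the
Kolyvagin prime and minus the point on `E`: only `2 ≤ rank_ℤ` of the twist model
`V = [0, D b₂, 0, 8 D² b₄, 16 D³ b₆]`. OUTPUT: for ANY frame `(Dt, β, ι)` and ANY datum `d` of conductor
`1`, `d.kolyvaginClass _ 1 = 0` — the class of the basic Heegner point `y_K = P(1)` DIES in
`H¹(K, E[p])` (g9's `kolyvaginClass_eq_zero_of_rank_of_datum_kodairaNeron`, twist disjunct
`ν + 2 ≤ rank E^{(d_K)}(ℚ)` with `ν = 0`, through the bridge `mordellWeilRank_quadraticTwist_eq_twistModel`).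
Points first: two independent rational points on `E^{(D)}` predict, mod `p`, the vanishing that
Gross–Zagier reads off `L'(E/K, 1) = 0`; a JLS-falsifiable prediction. CONDITIONAL on (γ); per-curve;
BSD is not proved by it. [cite: Kolyvagin1991MathAnn, Thm. 2.3 and Thm. 4]
[cite: GrossLMS1991, Prop. 3.7 (2), §4 (P_1 = y_K), §10] [cite: SilvermanAEC2009, VII.6.1] -/
theorem depthRowZeroTwist_vanishes_printKN_of_intModel_certificate
    (h372 : GrossLMS1991.prop37_2_frobeniusCongruence)
    (hcm : ¬ W.HasCM) (p : ℕ) [hp : Fact p.Prime] (hp2 : p ≠ 2)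
    (htower : ∀ n : ℕ, W.HasSurjectiveModNGaloisRep (p ^ n : ℕ))
    (K : Type) [Field K] [NumberField K] (hK : IsImaginaryQuadratic K) {D : ℤ}
    (hD : NumberField.discr K = D) (h3 : D ≠ -3) (h4 : D ≠ -4)
    {V : WeierstrassCurve ℤ}
    (hV : (⟨0, D * E₀.b₂, 0, 8 * D ^ 2 * E₀.b₄, 16 * D ^ 3 * E₀.b₆⟩ : WeierstrassCurve ℤ) = V)
    (hr' : 2 ≤ (V.map (Int.castRingHom ℚ)).mordellWeilRank)
    (hH : ∀ q : ℕ, q.Prime → (q : ℤ) ∣ E₀.Δ → (q = 2 → D % 8 = 1) ∧ (q ≠ 2 → jacobiSym D q = 1))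
    {Δ₀ : ℤ} (hΔ : E₀.Δ = Δ₀) {B : ℕ} (hB : Δ₀.natAbs < B ^ p)
    (htab : ∀ q ∈ Finset.range B, q.Prime → q ∣ Δ₀.natAbs →
      ∃ e ∈ Finset.range 64, q ^ e ∣ Δ₀.natAbs ∧ ¬ q ^ (e + 1) ∣ Δ₀.natAbs ∧ ¬ p ∣ e)
    (hadd : ∀ v : HeightOneSpectrum (𝓞 ℚ), W.HasAdditiveReductionAt v → p ≠ 3 ∨
      (W.kodairaSymbolAt v ≠ KodairaSymbol.IV ∧ W.kodairaSymbolAt v ≠ KodairaSymbol.IVstar))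
    [NeZero (W.conductorNorm ℤ)] (Dt : ModularParametrizationData W (W.conductorNorm ℤ)) (β : ℤ)
    (ι : K →+* ℂ) (d : KolyvaginHeegnerData Dt β ι 1) :
    d.kolyvaginClass hp.out 1 = 0 := by
  obtain ⟨c, hc, hcc⟩ := exists_conj_of_isImaginaryQuadratic K hK
  have hH' := satisfiesHeegnerHypothesis_conductorNorm_of_intModel hI K hK.1 hD hH
  have hmult : ∀ v : HeightOneSpectrum (𝓞 ℚ), W.HasMultiplicativeReductionAt v →
      ¬ p ∣ W.ordMinimalDiscriminant v :=
    not_dvd_ordMinimalDiscriminant_of_intModel_table hI hΔ hB htab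
  have hr2 : 2 ≤ (W.quadraticTwist (NumberField.discr K : ℚ)).mordellWeilRank := by
    rw [hD, mordellWeilRank_quadraticTwist_eq_twistModel hI D, hV]; exact hr'
  exact kolyvaginClass_eq_zero_of_rank_of_datum_kodairaNeron h372 hcm hK (by rw [hD]; exact h3)
    (by rw [hD]; exact h4) hH' p hp2 htower c hc hcc hmult hadd squarefree_one
    (fun q hq ↦ by simp [Nat.primeFactors_one] at hq) d
    (Or.inr (Or.inl (by rw [Nat.primeFactors_one, Finset.card_empty]; exact hr2)))

end Vanishing

end Summit.BirchSwinnertonDyer.BirchSwinnertonDyer.Theorems.KolyvaginDepthDoor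

end
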